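import Summits.HubbardSuperconductivity.HubbardSuperconductivity.Theorems.AnisotropyChordTransferFibre3FinXDCheck

/-!
# Route `AnisotropyChord` / H0 rotor rung: FIN per-`L` row-D (KT-2a″) SUB-CELL facts, `L = 11` (12–17)

Row-D facts `xdCellAny0 11 (49/50) la lb aD = true` on quarter sub-cells of the combined cells whose side condition needs `aD ≈ .04` (mechhunt STATUS p3 g7 REPORT 3).
Prover seat `hubbard-h0-rotor-p3` g7; helper for piece A = stmt-HubbardSuperconductivity-23918 of rung 19089 (`--supports`, helper class).
WHAT THIS IS NOT: nothing here proves superconductivity in the Hubbard model (rotor TARGET as worded stays FALSE, g15 verdict); kernel facts /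
assembly for ONE conditional reduction at one `L`.  No sorry.
-/

set_option linter.dupNamespace false
set_option autoImplicit false

namespace Summit.HubbardSuperconductivity.HubbardSuperconductivity.Theorems.AnisotropyChord.Transfer.Fibre3

namespace FinXD

/-- row-D sub-cell `[14995313511643751, 15089034221091524]` of `L = 11`. [folklore] -/
theorem xd11s_140_0 : xdCellAny0 11 (49/50 : ℚ) 14995313511643751 15089034221091524 (1/25 : ℚ) = true := by decide +kernel

/-- row-D sub-cell `[15089034221091524, 15182754930539298]` of `L = 11`. [folklore] -/
theorem xd11s_140_1 : xdCellAny0 11 (49/50 : ℚ) 15089034221091524 15182754930539298 (1/25 : ℚ) = true := by decide +kernel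

/-- row-D sub-cell `[15182754930539298, 15276475639987071]` of `L = 11`. [folklore] -/
theorem xd11s_140_2 : xdCellAny0 11 (49/50 : ℚ) 15182754930539298 15276475639987071 (1/25 : ℚ) = true := by decide +kernel

/-- row-D sub-cell `[15276475639987071, 15370196349434845]` of `L = 11`. [folklore] -/
theorem xd11s_140_3 : xdCellAny0 11 (49/50 : ℚ) 15276475639987071 15370196349434845 (1/25 : ℚ) = true := by decide +kernel

/-- row-D sub-cell `[15370196349434845, 15466260076618812]` of `L = 11`. [folklore] -/
theorem xd11s_141_0 : xdCellAny0 11 (49/50 : ℚ) 15370196349434845 15466260076618812 (1/25 : ℚ) = true := by decide +kernel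

/-- row-D sub-cell `[15466260076618812, 15562323803802780]` of `L = 11`. [folklore] -/
theorem xd11s_141_1 : xdCellAny0 11 (49/50 : ℚ) 15466260076618812 15562323803802780 (1/25 : ℚ) = true := by decide +kernel

end FinXD

end Summit.HubbardSuperconductivity.HubbardSuperconductivity.Theorems.AnisotropyChord.Transfer.Fibre3
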